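import Summits.CriticalPhenomena.PercolationContinuityZ3.Theorems.Transplant.FKConnectivityAllQAntipodalTwoSpineInduction
import HarnessLib

/-!
# Two-spine word model of `U¹¹` — BASE CASES of the mode induction by checkable Farkas–Bernstein certificates

Theorem file (`--supports stmt-CriticalPhenomena-4575`), FK sub-lane `prim-bschramm-fk-2` (gen 15); builds on p205010 (kernel
theorem, internal audit signed; external expert review pending).  No named facts, no sorries.

For the empty shapes (`A = {y}`, `B = {z}`) a diagram statement reads `∑_i q^{e_i} Θ^{m_i}(∅,∅) s_i ≥ 0` for all reals `s_i ≥ 0`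
with `s_i ≤ s_j` along `D.le`, where `Θ^{m}(∅,∅)` is an explicit polynomial in `q` (`FK.TwoSpine.baseTerms`, `FK.TwoSpine.theta_nil_nil`).
A BASE CERTIFICATE gives polynomials `μ_i, λ_p ≥ 0` on `[0,1]` in BERNSTEIN FORM (nonnegative integer combinations of
`q^a (1-q)^b`) and a positive integer `d` with `d · q^{e_i} Θ^{m_i}(∅,∅) = μ_i - ∑_{p = (i,·)} λ_p + ∑_{p = (·,i)} λ_p` as
polynomials (dense integer coefficient lists, `FK.TwoSpine.BaseCert.check`); then the statement follows for `0 ≤ q ≤ 1`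
(`FK.TwoSpine.DStmt.nil_nil_of_baseCert`).  Tiny dense-polynomial kit: `padd`, `pneg`, `psmul`, `pshift`, `bern`, `peval`.
[cite: Grimmett2006, §3.8 (pp. 61–62)]
-/

noncomputable section

namespace Summit.CriticalPhenomena.PercolationContinuityZ3.Theorems

namespace FK

namespace TwoSpine

open X2Word

/-! ### Dense integer polynomials -/

/-- Evaluate a dense integer coefficient list at a real point: `peval q [c₀, c₁, …] = ∑ c_j q^j`. [folklore] -/
def peval (q : ℝ) : List ℤ → ℝ
  | [] => 0
  | c :: p => (c : ℝ) + q * peval q p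

/-- Coefficientwise sum of dense polynomials. [folklore] -/
def padd : List ℤ → List ℤ → List ℤ
  | [], r => r
  | p, [] => p
  | c :: p, d :: r => (c + d) :: padd p r

/-- Negation. [folklore] -/
def pneg (p : List ℤ) : List ℤ := p.map (- ·)

/-- Integer scaling. [folklore] -/
def psmul (c : ℤ) (p : List ℤ) : List ℤ := p.map (c * ·)

/-- Multiplication by `q^a` (shift). [folklore] -/
def pshift (a : ℕ) (p : List ℤ) : List ℤ := List.replicate a 0 ++ p

/-- The BERNSTEIN monomial `q^a (1-q)^b` as a dense polynomial, via `(1-q)^{b+1} q^a = (1-q)^b q^a - (1-q)^b q^{a+1}`. [folklore] -/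
def bern : ℕ → ℕ → List ℤ
  | a, 0 => pshift a [1]
  | a, b + 1 => padd (bern a b) (pneg (bern (a + 1) b))

/-- A polynomial is (coefficientwise) zero. [folklore] -/
def pIsZero (p : List ℤ) : Bool := p.all (· == 0)

/-- `peval` of a sum. [folklore] -/
theorem peval_padd (q : ℝ) (p r : List ℤ) : peval q (padd p r) = peval q p + peval q r := by
  induction p generalizing r with
  | nil => simp [padd, peval]
  | cons c p ih =>
    cases r with
    | nil => simp [padd, peval]
    | cons d r => simp only [padd, peval, ih, Int.cast_add]; ring

/-- `peval` of a negation. [folklore] -/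
theorem peval_pneg (q : ℝ) (p : List ℤ) : peval q (pneg p) = - peval q p := by
  induction p with
  | nil => simp [pneg, peval]
  | cons c p ih => simp only [pneg, List.map_cons, peval, Int.cast_neg] at ih ⊢; rw [ih]; ring

/-- `peval` of a scaling. [folklore] -/
theorem peval_psmul (q : ℝ) (c : ℤ) (p : List ℤ) : peval q (psmul c p) = c * peval q p := by
  induction p with
  | nil => simp [psmul, peval]
  | cons d p ih => simp only [psmul, List.map_cons, peval, Int.cast_mul] at ih ⊢; rw [ih]; ring

/-- `peval` of a shift. [folklore] -/
theorem peval_pshift (q : ℝ) (a : ℕ) (p : List ℤ) : peval q (pshift a p) = q ^ a * peval q p := by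
  induction a with
  | zero => simp [pshift]
  | succ a ih => simp only [pshift, List.replicate_succ, List.cons_append, peval, Int.cast_zero, zero_add] at ih ⊢; rw [ih]; ring

/-- `peval` of a Bernstein monomial. [folklore] -/
theorem peval_bern (q : ℝ) (a b : ℕ) : peval q (bern a b) = q ^ a * (1 - q) ^ b := by
  induction b generalizing a with
  | zero => simp [bern, peval_pshift, peval]
  | succ b ih => rw [bern, peval_padd, peval_pneg, ih, ih]; ring

/-- A coefficientwise-zero polynomial evaluates to zero. [folklore] -/
theorem peval_eq_zero_of_pIsZero (q : ℝ) {p : List ℤ} (h : pIsZero p = true) : peval q p = 0 := by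
  induction p with
  | nil => rfl
  | cons c p ih =>
    simp only [pIsZero, List.all_cons, Bool.and_eq_true, beq_iff_eq] at h
    simp only [peval, h.1, Int.cast_zero, zero_add, ih (by simpa [pIsZero] using h.2), mul_zero]

/-- A BERNSTEIN FORM: a list of `(weight, a, b)` standing for `∑ weight · q^a (1-q)^b` (nonnegative on `[0,1]`). [folklore] -/
abbrev BForm := List (ℕ × ℕ × ℕ)

/-- The dense polynomial of a Bernstein form. [folklore] -/
def BForm.poly (f : BForm) : List ℤ := f.foldr (fun t acc => padd (psmul (t.1 : ℤ) (bern t.2.1 t.2.2)) acc) []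

/-- The value of a Bernstein form. [folklore] -/
def BForm.val (q : ℝ) (f : BForm) : ℝ := peval q f.poly

/-- Bernstein forms are nonnegative on `[0, 1]`. [folklore] -/
theorem BForm.val_nonneg {q : ℝ} (hq0 : 0 ≤ q) (hq1 : q ≤ 1) (f : BForm) : 0 ≤ f.val q := by
  unfold BForm.val BForm.poly
  induction f with
  | nil => simp [peval]
  | cons t f ih =>
    rw [List.foldr_cons, peval_padd, peval_psmul, peval_bern]
    exact add_nonneg (mul_nonneg (by exact_mod_cast t.1.zero_le) (mul_nonneg (pow_nonneg hq0 _) (pow_nonneg (by linarith) _))) ih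

/-! ### The base coefficients `Θ^m(∅, ∅)` -/

/-- Integer connection of an empty row in mode `m` (marked edge absent). [folklore] -/
def Mode.connNil : Mode → ℤ | .o => 0 | .c => 1 | .f => 1 | .z => 0 | .x => 0
/-- Integer connection of an empty row in mode `m` (marked edge inserted). [folklore] -/
def Mode.connDotNil : Mode → ℤ | .o => 1 | .c => 1 | .f => 1 | .z => 0 | .x => 0
/-- `δ` of an empty row in mode `m`. [folklore] -/
def Mode.delNil : Mode → ℕ | .o => 1 | .c => 0 | .f => 1 | .z => 1 | .x => 0

/-- The real connection of the empty row is the cast of `connNil`. [folklore] -/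
theorem Mode.conn_nil (m : Mode) : m.conn [] = (m.connNil : ℝ) := by cases m <;> simp [Mode.conn, Mode.connNil, rowC, lastP]
/-- The real dotted connection of the empty row is the cast of `connDotNil`. [folklore] -/
theorem Mode.connDot_nil (m : Mode) : m.connDot [] = (m.connDotNil : ℝ) := by
  cases m <;> simp [Mode.connDot, Mode.connDotNil, rowCdot]
/-- `δ` of the empty row. [folklore] -/
theorem Mode.del_nil (m : Mode) : m.del [] = m.delNil := by
  cases m <;> simp [Mode.del, Mode.delNil, rowDel, rowDelW, headP]
/-- No cluster shift on the empty row. [folklore] -/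
theorem Mode.shift_nil (m : Mode) : m.shift [] = 0 := by cases m <;> simp [Mode.shift, rowC, lastP]

/-- **The base coefficient `Θ^m(∅, ∅)` as a dense integer polynomial** (series top: two monomials; parallel top: with the
parallel corrections). [folklore] -/
def baseTerms (top : Top) (m : Modes) : List ℤ :=
  let a := m.1.connNil; let ad := m.1.connDotNil; let ab := m.2.1.connNil; let abd := m.2.1.connDotNil
  let b := m.2.2.1.connNil; let bd := m.2.2.1.connDotNil; let bb := m.2.2.2.connNil; let bbd := m.2.2.2.connDotNil
  let e₁ := 2 - m.1.delNil - m.2.2.2.delNil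
  let e₂ := 2 - m.2.1.delNil - m.2.2.1.delNil
  match top with
  | .W => padd (pshift e₁ [ad * b - ab * bbd]) (pshift e₂ [a * bd - abd * bb])
  | .P => padd (pshift (e₁ + (if ad * b = 1 then 1 else 0) + (if ab * bbd = 1 then 1 else 0)) [(ad + b - ad * b) - (ab + bbd - ab * bbd)])
      (pshift (e₂ + (if a * bd = 1 then 1 else 0) + (if abd * bb = 1 then 1 else 0)) [(a + bd - a * bd) - (abd + bb - abd * bb)])

/-- **`Θ^m(∅, ∅)` is the evaluation of `baseTerms`.** [folklore] -/
theorem theta_nil_nil (q : ℝ) (top : Top) (m : Modes) : theta q top m [] [] = peval q (baseTerms top m) := by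
  have hadj : adjP false ([] : List Kind) = 0 := rfl
  have hb : baseExp m [] [] = 0 := by simp [baseExp, sRowA, sRowB, rowCorr, Mode.shift_nil, hadj]
  unfold theta baseTerms
  simp only [sRowA_nil, sRowB, List.filter_nil, List.map_nil, Mode.conn_nil, Mode.connDot_nil, Mode.del_nil, hb, pow_zero, one_mul]
  have cast01 : ∀ x y : ℤ, ((x : ℝ) * (y : ℝ) = 1) ↔ (x * y = 1) := fun x y => by exact_mod_cast Iff.rfl
  cases top
  · simp only [peval_padd, peval_pshift, peval, Int.cast_sub, Int.cast_mul, mul_zero, add_zero]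
  · simp only [peval_padd, peval_pshift, peval, Int.cast_sub, Int.cast_mul, Int.cast_add, mul_zero, add_zero, cast01]; ring

/-! ### Base certificates -/

/-- Sum of a list of dense polynomials. [folklore] -/
def psum (L : List (List ℤ)) : List ℤ := L.foldr padd []

/-- `peval` of `psum`. [folklore] -/
theorem peval_psum (q : ℝ) (L : List (List ℤ)) : peval q (psum L) = (L.map (peval q)).sum := by
  induction L with
  | nil => rfl
  | cons p L ih => simp only [psum, List.foldr_cons, List.map_cons, List.sum_cons] at ih ⊢; rw [peval_padd, ih]

/-- List sums over `range` are `Finset.range` sums. [folklore] -/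
theorem sum_map_range_eq (n : ℕ) (f : ℕ → ℝ) : ((List.range n).map f).sum = ∑ t ∈ Finset.range n, f t := by
  rw [← List.sum_toFinset _ List.nodup_range, List.toFinset_range]

/-- A BASE CERTIFICATE for a diagram: a positive scaling `d`, one Bernstein form `μ_i` per node and one `λ_t` per order
constraint (by position `t` in `D.le`). [folklore] -/
structure BaseCert where
  /-- positive integer scaling of the identity -/
  d : ℕ
  /-- `μ_i`, indexed by node -/
  mu : List BForm
  /-- `λ_t`, indexed by position in `D.le` -/
  lam : List BForm

/-- The contribution of order constraint `t` to node `i`: `+λ_t` if `le[t] = (·, i)`, `-λ_t` if `le[t] = (i, ·)`. [folklore] -/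
def BaseCert.lamTerm (D : Diagram) (bc : BaseCert) (i t : ℕ) : List ℤ :=
  padd (if (D.le.getD t (0, 0)).2 = i then (bc.lam.getD t []).poly else [])
    (if (D.le.getD t (0, 0)).1 = i then pneg (bc.lam.getD t []).poly else [])

/-- The right-hand side polynomial of node `i`: `μ_i + ∑_t lamTerm i t`. [folklore] -/
def BaseCert.rhs (D : Diagram) (bc : BaseCert) (i : ℕ) : List ℤ :=
  padd (bc.mu.getD i []).poly (psum ((List.range D.le.length).map (bc.lamTerm D i)))

/-- The decidable CHECK of a base certificate (`top` fixed): positivity of `d`, in-range order constraints, and the polynomial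
identities `d · q^{e_i} Θ^{m_i}(∅,∅) = rhs_i` node by node. [folklore] -/
def BaseCert.check (top : Top) (D : Diagram) (bc : BaseCert) : Bool :=
  decide (0 < bc.d) &&
  (D.le.all fun p => decide (p.1 < D.nodes.length) && decide (p.2 < D.nodes.length)) &&
  (List.range D.nodes.length).all fun i =>
    pIsZero (padd (psmul bc.d (pshift (D.nodes.getD i dfltNode).2 (baseTerms top (D.nodes.getD i dfltNode).1))) (pneg (bc.rhs D i)))

/-- Evaluation of `lamTerm`. [folklore] -/
theorem BaseCert.peval_lamTerm (q : ℝ) (D : Diagram) (bc : BaseCert) (i t : ℕ) :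
    peval q (bc.lamTerm D i t) = (if (D.le.getD t (0, 0)).2 = i then (bc.lam.getD t []).val q else 0) -
      (if (D.le.getD t (0, 0)).1 = i then (bc.lam.getD t []).val q else 0) := by
  unfold BaseCert.lamTerm BForm.val
  rw [peval_padd]
  split_ifs <;> simp [peval_pneg, peval]

/-- Evaluation of the right-hand side. [folklore] -/
theorem BaseCert.peval_rhs (q : ℝ) (D : Diagram) (bc : BaseCert) (i : ℕ) :
    peval q (bc.rhs D i) = (bc.mu.getD i []).val q +
      ∑ t ∈ Finset.range D.le.length,
        ((if (D.le.getD t (0, 0)).2 = i then (bc.lam.getD t []).val q else 0) -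
          (if (D.le.getD t (0, 0)).1 = i then (bc.lam.getD t []).val q else 0)) := by
  unfold BaseCert.rhs BForm.val
  rw [peval_padd, peval_psum, List.map_map, ← sum_map_range_eq]
  congr 1
  refine congrArg List.sum (List.map_congr_left fun t _ => ?_)
  rw [Function.comp_apply, BaseCert.peval_lamTerm]
  rfl

/-- **BASE CASE from a checked base certificate** (`0 ≤ q ≤ 1`). [folklore] -/
theorem DStmt.nil_nil_of_baseCert {q : ℝ} (hq0 : 0 ≤ q) (hq1 : q ≤ 1) {top : Top} {D : Diagram} {bc : BaseCert}
    (hc : bc.check top D = true) : DStmt q top D [] [] := by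
  intro S hS
  unfold BaseCert.check at hc
  simp only [Bool.and_eq_true, decide_eq_true_eq, List.all_eq_true, List.mem_range] at hc
  obtain ⟨⟨hd, hle⟩, hid⟩ := hc
  -- the node values `s_i` and the identity node by node
  set s : ℕ → ℝ := fun i => S i [] [] with hs
  have hnode : ∀ i < D.nodes.length, (bc.d : ℝ) * (q ^ (D.nodes.getD i dfltNode).2 * theta q top (D.nodes.getD i dfltNode).1 [] []) =
      peval q (bc.rhs D i) := by
    intro i hi
    have h0 := peval_eq_zero_of_pIsZero q (hid i hi)
    rw [peval_padd, peval_pneg, peval_psmul, peval_pshift, ← theta_nil_nil] at h0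
    push_cast at h0 ⊢
    linarith
  -- rewrite the diagram sum
  have hdsum : (bc.d : ℝ) * dsum q top D [] [] S =
      ∑ i ∈ Finset.range D.nodes.length, peval q (bc.rhs D i) * s i := by
    rw [dsum_eq, Finset.mul_sum]
    refine Finset.sum_congr rfl fun i hi => ?_
    rw [Finset.mem_range] at hi
    simp only [kindWords, Finset.sum_singleton, hs]
    rw [← hnode i hi]
    ring
  have hdpos : (0 : ℝ) < bc.d := by exact_mod_cast hd
  suffices h : 0 ≤ (bc.d : ℝ) * dsum q top D [] [] S from (mul_nonneg_iff_of_pos_left hdpos).1 h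
  rw [hdsum]
  simp_rw [BaseCert.peval_rhs, add_mul, Finset.sum_add_distrib, Finset.sum_mul]
  refine add_nonneg (Finset.sum_nonneg fun i _ => mul_nonneg (BForm.val_nonneg hq0 hq1 _) (hS.nonneg _ _ _)) ?_
  rw [Finset.sum_comm]
  refine Finset.sum_nonneg fun t ht => ?_
  rw [Finset.mem_range] at ht
  have hmem : D.le.getD t (0, 0) ∈ D.le := by
    rw [List.getD_eq_getElem?_getD, List.getElem?_eq_getElem ht]; exact List.getElem_mem ht
  obtain ⟨h1, h2⟩ := hle _ hmem
  -- the inner sum over nodes picks out the two endpoints of constraint `t`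
  have hsum : ∑ i ∈ Finset.range D.nodes.length,
      ((if (D.le.getD t (0, 0)).2 = i then (bc.lam.getD t []).val q else 0) -
        (if (D.le.getD t (0, 0)).1 = i then (bc.lam.getD t []).val q else 0)) * s i =
      (bc.lam.getD t []).val q * s (D.le.getD t (0, 0)).2 - (bc.lam.getD t []).val q * s (D.le.getD t (0, 0)).1 := by
    simp only [sub_mul, Finset.sum_sub_distrib, ite_mul, zero_mul]
    rw [Finset.sum_ite_eq (Finset.range D.nodes.length) (D.le.getD t (0, 0)).2 (fun i => (bc.lam.getD t []).val q * s i),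
      Finset.sum_ite_eq (Finset.range D.nodes.length) (D.le.getD t (0, 0)).1 (fun i => (bc.lam.getD t []).val q * s i),
      if_pos (Finset.mem_range.2 h2), if_pos (Finset.mem_range.2 h1)]
  rw [hsum]
  have hst : s (D.le.getD t (0, 0)).1 ≤ s (D.le.getD t (0, 0)).2 := hS.le _ hmem [] []
  nlinarith [BForm.val_nonneg hq0 hq1 (bc.lam.getD t [])]

/-- The default (trivial) base certificate. [folklore] -/
def dfltBaseCert : BaseCert := ⟨1, [], []⟩

/-- All base certificates of a family check (member `d` against certificate `d`). [folklore] -/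
def baseAll (top : Top) (fam : List Diagram) (bcs : List BaseCert) : Bool :=
  (List.range fam.length).all fun d => (bcs.getD d dfltBaseCert).check top (fam.getD d dfltDiagram)

/-- **All base cases of a family from a checked list of base certificates** (`0 ≤ q ≤ 1`). [folklore] -/
theorem DStmt.nil_nil_of_baseAll {q : ℝ} (hq0 : 0 ≤ q) (hq1 : q ≤ 1) {top : Top} {fam : List Diagram} {bcs : List BaseCert}
    (h : baseAll top fam bcs = true) : ∀ D ∈ fam, DStmt q top D [] [] := by
  intro D hD
  obtain ⟨d, hd, rfl⟩ := (mem_iff_getD fam dfltDiagram D).1 hD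
  unfold baseAll at h
  simp only [List.all_eq_true, List.mem_range] at h
  exact DStmt.nil_nil_of_baseCert hq0 hq1 (h d hd)

/-- **THE MODE INDUCTION, packaged**: a checked closure certificate and checked base certificates prove every member of the family
for all pairs of spine shapes, for `0 ≤ q ≤ 1` (memo g15 §6). [folklore] -/
theorem Cert.sound_of_baseAll {q : ℝ} (hq0 : 0 ≤ q) (hq1 : q ≤ 1) (top : Top) (C : Cert) (hc : C.check = true)
    {bcs : List BaseCert} (hb : baseAll top C.family bcs = true) :
    ∀ D ∈ C.family, ∀ oA oB : List Kind, DStmt q top D oA oB :=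
  Cert.sound hq0 top C hc (DStmt.nil_nil_of_baseAll hq0 hq1 hb)

end TwoSpine

end FK

end Summit.CriticalPhenomena.PercolationContinuityZ3.Theorems

end
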